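import Summits.KontsevichZagierPeriods.KontsevichZagierPeriods.Theorems.SoloInformedParamTerm
import HarnessLib

/-!
# Real semialgebraic data are fibres of `ℚ`-semialgebraic families

The input half of the definability programme (kernel THEOREM R / T for bounded `KZ_ℝ` chains):

* `soloInformed_ratFamilyFibre_of_isSemialgebraic`: every `ℝ`-semialgebraic set
  `s ⊆ ℝⁿ` is the fibre `{x | (p₀, x) ∈ S}` of a `ℚ`-semialgebraic family `S ⊆ ℝ^K × ℝⁿ` at a real
  parameter `p₀` (take the coefficients of the defining polynomials as parameters; induction over
  the generating Boolean algebra);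
* `soloInformed_exists_pterm_of_funOn`: an `ℝ`-semialgebraic function on an `ℝ`-semialgebraic
  set is the graph-value function of a functional parametrised term at some parameter;
* `soloInformed_exists_pterm_rep`: every BOUNDED integral representation over `ℝ` is denoted,
  `T.rep p₀ = r`, by an admissible parametrised term (`SoloInformedPTerm`) at some real parameter.

References: [cite: BochnakCosteRoy1998, Def. 2.1.4, Prop. 2.2.4];
[cite: KontsevichZagier2001, §1.1].
-/

noncomputable section

open Set MeasureTheory MvPolynomial Literature.ModelTheory.ExponentialFields
  Literature.NumberTheory.Transcendental

namespace Summit.KontsevichZagierPeriods.KontsevichZagierPeriods.Theorems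

/-! ### Sets -/

/-- `s ⊆ ℝⁿ` is the fibre at a real parameter of a `ℚ`-semialgebraic family with finitely many
parameters. [cite: BochnakCosteRoy1998, Def. 2.1.4] -/
def SoloInformedRatFamilyFibre {n : ℕ} (s : Set (Fin n → ℝ)) : Prop :=
  ∃ (K : Type) (_ : Fintype K) (S : Set (K ⊕ Fin n → ℝ)) (p : K → ℝ),
    IsSemialgebraic ℚ S ∧ {x | Sum.elim p x ∈ S} = s

/-- The polynomial with indeterminate coefficients (indexed by the support of `q`) and the
monomials of `q`: `∑_{m ∈ supp q} c_m · x^m ∈ ℚ[c, x]`. [cite: BochnakCosteRoy1998, Def. 2.1.4] -/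
def soloInformedCoeffPoly {n : ℕ} (q : MvPolynomial (Fin n) ℝ) :
    MvPolynomial (q.support ⊕ Fin n) ℚ :=
  ∑ m : q.support, X (Sum.inl m) * rename Sum.inr (monomial m.1 1)

/-- Specialising the indeterminate coefficients to the coefficients of `q` recovers `q`.
[cite: BochnakCosteRoy1998, Def. 2.1.4] -/
theorem soloInformed_aeval_coeffPoly {n : ℕ} (q : MvPolynomial (Fin n) ℝ) (x : Fin n → ℝ) :
    aeval (Sum.elim (fun m : q.support => q.coeff m.1) x) (soloInformedCoeffPoly q) =
      aeval x q := by
  simp only [soloInformedCoeffPoly, map_sum, map_mul, aeval_X, Sum.elim_inl, aeval_rename,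
    Sum.elim_comp_inr, aeval_monomial, map_one, one_mul]
  rw [Finset.sum_coe_sort q.support (fun m => q.coeff m * m.prod fun i e => x i ^ e)]
  conv_rhs => rw [q.as_sum, map_sum]
  refine Finset.sum_congr rfl fun m _ => ?_
  rw [aeval_monomial, Algebra.algebraMap_self, RingHom.id_apply]

/-- **Every real semialgebraic set is a fibre of a `ℚ`-semialgebraic family.**
[cite: BochnakCosteRoy1998, Def. 2.1.4] -/
theorem soloInformed_ratFamilyFibre_of_isSemialgebraic {n : ℕ} {s : Set (Fin n → ℝ)}
    (hs : IsSemialgebraic ℝ s) : SoloInformedRatFamilyFibre s := by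
  induction hs using BooleanSubalgebra.closure_bot_sup_induction with
  | mem s hs =>
    rcases hs with ⟨q, rfl⟩ | ⟨q, rfl⟩
    · refine ⟨_, inferInstance, _, fun m : q.support => q.coeff m.1,
        isSemialgebraic_setOf_eval_eq_zero (soloInformedCoeffPoly q), ?_⟩
      ext x
      simp only [mem_setOf_eq, soloInformed_aeval_coeffPoly]
    · refine ⟨_, inferInstance, _, fun m : q.support => q.coeff m.1,
        isSemialgebraic_setOf_eval_pos (soloInformedCoeffPoly q), ?_⟩
      ext x
      simp only [mem_setOf_eq, soloInformed_aeval_coeffPoly]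
  | bot =>
    exact ⟨Fin 0, inferInstance, ∅, fun i => i.elim0, isSemialgebraic_empty, by ext x; simp⟩
  | sup s _ t _ hs ht =>
    obtain ⟨K₁, _, S₁, p₁, hS₁, rfl⟩ := hs
    obtain ⟨K₂, _, S₂, p₂, hS₂, rfl⟩ := ht
    refine ⟨K₁ ⊕ K₂, inferInstance,
      {w | w ∘ Sum.map Sum.inl id ∈ S₁} ∪ {w | w ∘ Sum.map Sum.inr id ∈ S₂}, Sum.elim p₁ p₂,
      (hS₁.preimage_comp _).union (hS₂.preimage_comp _), ?_⟩
    ext x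
    simp only [mem_setOf_eq, mem_union, SoloInformedPTerm.sumElim_comp_sumMap,
      Sum.elim_comp_inl, Sum.elim_comp_inr, Set.sup_eq_union]
  | compl s _ hs =>
    obtain ⟨K, _, S, p, hS, rfl⟩ := hs
    exact ⟨K, inferInstance, Sᶜ, p, hS.compl, by ext x; simp⟩

/-! ### Functions and representations -/

/-- Joining two families over parameter spaces `K₁`, `K₂` into one term over `K₁ ⊕ K₂`: the
domain family pulled back from `K₁`, the graph family from `K₂`.
[cite: BochnakCosteRoy1998, Def. 2.2.5] -/
def soloInformedJoinTerm {K₁ K₂ : Type} {d : ℕ} (S : Set (K₁ ⊕ Fin d → ℝ))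
    (G : Set (K₂ ⊕ Fin (d + 1) → ℝ)) (φ : (Fin d → ℝ) → ℝ) (hS : IsSemialgebraic ℚ S)
    (hG : IsSemialgebraic ℚ G) : SoloInformedPTerm (K₁ ⊕ K₂) d where
  S := {w | w ∘ Sum.map Sum.inl id ∈ S}
  G := {w | w ∘ Sum.map Sum.inr id ∈ G}
  φ := φ
  hS := hS.preimage_comp _
  hG := hG.preimage_comp _

/-- Fibre of the joined term. [cite: BochnakCosteRoy1998, Def. 2.2.5] -/
theorem soloInformed_fibre_joinTerm {K₁ K₂ : Type} {d : ℕ} (S : Set (K₁ ⊕ Fin d → ℝ))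
    (G : Set (K₂ ⊕ Fin (d + 1) → ℝ)) (φ : (Fin d → ℝ) → ℝ) (hS : IsSemialgebraic ℚ S)
    (hG : IsSemialgebraic ℚ G) (p₁ : K₁ → ℝ) (p₂ : K₂ → ℝ) :
    (soloInformedJoinTerm S G φ hS hG).fibre (Sum.elim p₁ p₂) = {x | Sum.elim p₁ x ∈ S} := by
  ext x
  simp only [SoloInformedPTerm.mem_fibre, soloInformedJoinTerm, mem_setOf_eq,
    SoloInformedPTerm.sumElim_comp_sumMap, Sum.elim_comp_inl]

/-- Graph fibre of the joined term. [cite: BochnakCosteRoy1998, Def. 2.2.5] -/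
theorem soloInformed_gfibre_joinTerm {K₁ K₂ : Type} {d : ℕ} (S : Set (K₁ ⊕ Fin d → ℝ))
    (G : Set (K₂ ⊕ Fin (d + 1) → ℝ)) (φ : (Fin d → ℝ) → ℝ) (hS : IsSemialgebraic ℚ S)
    (hG : IsSemialgebraic ℚ G) (p₁ : K₁ → ℝ) (p₂ : K₂ → ℝ) :
    (soloInformedJoinTerm S G φ hS hG).gfibre (Sum.elim p₁ p₂) = {z | Sum.elim p₂ z ∈ G} := by
  ext z
  simp only [SoloInformedPTerm.mem_gfibre, soloInformedJoinTerm, mem_setOf_eq,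
    SoloInformedPTerm.sumElim_comp_sumMap, Sum.elim_comp_inr]

/-- **Every real semialgebraic function on a real semialgebraic set is the graph-value function
of a functional parametrised term** (with prescribed off-domain values `φ`).
[cite: BochnakCosteRoy1998, Def. 2.2.5] -/
theorem soloInformed_exists_pterm_of_funOn {d : ℕ} {s : Set (Fin d → ℝ)} {f : (Fin d → ℝ) → ℝ}
    (hs : IsSemialgebraic ℝ s) (hf : IsSemialgebraicFunOn ℝ s f) (φ : (Fin d → ℝ) → ℝ) :
    ∃ (K : Type) (_ : Fintype K) (T : SoloInformedPTerm K d) (p₀ : K → ℝ),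
      T.SoloInformedFunctional p₀ ∧ T.fibre p₀ = s ∧
      (∀ x ∈ s, ∀ t, Fin.snoc x t ∈ T.gfibre p₀ ↔ t = f x) ∧ (∀ x ∈ s, T.gval p₀ x = f x) ∧
      T.φ = φ := by
  obtain ⟨K₁, _, S, p₁, hS, hSfib⟩ := soloInformed_ratFamilyFibre_of_isSemialgebraic hs
  obtain ⟨K₂, _, G, p₂, hG, hGfib⟩ := soloInformed_ratFamilyFibre_of_isSemialgebraic hf
  have hfib : (soloInformedJoinTerm S G φ hS hG).fibre (Sum.elim p₁ p₂) = s := by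
    rw [soloInformed_fibre_joinTerm, hSfib]
  have hgraph : ∀ x ∈ s, ∀ t,
      Fin.snoc x t ∈ (soloInformedJoinTerm S G φ hS hG).gfibre (Sum.elim p₁ p₂) ↔ t = f x := by
    intro x hx t
    rw [soloInformed_gfibre_joinTerm, hGfib]
    simp only [mem_setOf_eq]
    constructor
    · rintro ⟨x', -, h⟩
      obtain ⟨rfl, rfl⟩ := Fin.snoc_injective2.eq_iff.1 h
      rfl
    · rintro rfl
      exact ⟨x, hx, rfl⟩
  have hfun : (soloInformedJoinTerm S G φ hS hG).SoloInformedFunctional (Sum.elim p₁ p₂) := by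
    intro x hx
    rw [hfib] at hx
    exact ⟨⟨f x, (hgraph x hx _).2 rfl⟩, fun t t' ht ht' => by
      rw [(hgraph x hx t).1 ht, (hgraph x hx t').1 ht']⟩
  refine ⟨K₁ ⊕ K₂, inferInstance, soloInformedJoinTerm S G φ hS hG, Sum.elim p₁ p₂, hfun, hfib,
    hgraph, fun x hx => ?_, rfl⟩
  exact SoloInformedPTerm.gval_eq hfun (hfib.symm ▸ hx) ((hgraph x hx _).2 rfl)

/-- **Every bounded real integral representation is denoted by an admissible parametrised term
at some real parameter.** [cite: KontsevichZagier2001, §1.1] -/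
theorem soloInformed_exists_pterm_rep {d : ℕ} (r : KZOver.IntegralRep ℝ d)
    (hr : SoloInformedBddRep r) :
    ∃ (K : Type) (_ : Fintype K) (T : SoloInformedPTerm K d) (p₀ : K → ℝ),
      T.SoloInformedAdm p₀ ∧ T.rep p₀ = r ∧ T.φ = r.integrand := by
  obtain ⟨K, _, T, p₀, hfun, hfib, hgraph, -, hφ⟩ :=
    soloInformed_exists_pterm_of_funOn r.isSemialgebraic_domain r.isSemialgebraicFunOn_integrand
      r.integrand
  have hb : T.SoloInformedBounded p₀ := by
    obtain ⟨M, hM₁, hM₂⟩ := hr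
    refine ⟨M, fun x hx => hM₁ x (hfib ▸ hx), fun x hx t ht => ?_⟩
    rw [hfib] at hx
    rw [(hgraph x hx t).1 ht]
    exact hM₂ x hx
  refine ⟨K, inferInstance, T, p₀, ⟨hfun, hb⟩, ?_, hφ⟩
  refine SoloInformedPTerm.rep_eq_of_graph r hfib.symm (fun x hx => hgraph x (hfib ▸ hx))
    (fun x _ => by rw [hφ]) hb

end Summit.KontsevichZagierPeriods.KontsevichZagierPeriods.Theorems
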